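import Summits.QuantumFields.BalabanUV.Beta.GAN24.InsertionChainVolumeLimit

/-!
# `BalabanUV.Beta.GAN24.SecondDerivativeVolumeLimit` — binder row G-an2-4 ∕ (CONV-C), route R7 «TWO CURRENCIES», PART 157: THE SECOND u-DERIVATIVE OF THE EFFECTIVE FORM AT `U = 1`,
# `Σ̈_k = 2·(c_k⁻¹X^{(1)}_kc_k⁻¹X^{(1)}_kc_k⁻¹ − c_k⁻¹X^{(2)}_kc_k⁻¹)` (PART 121's `∂_t²(c_k(t)⁻¹)|₀` for the first-order model: `ċ_k = X^{(1)}_k`, `c̈_k∕2 = X^{(2)}_k`), HAS THE β-CELL's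
# WHOLE `LimitRate` END ON `ℤ^d`, MODULO ONLY THE BACKGROUND's POINTWISE LIMIT — the order in the background at which the one-loop vacuum-polarization shape of (1.22) lives.  Assembly:
# PART 143's inputs of `c_k⁻¹`, PART 156's inputs of `X^{(1)}`, `X^{(2)}` (decay for every torus; EL₂ modulo EL₁ of `V_t`), six product steps of PART 156's `mul_inputs` at a common rate,
# PART 130's linear closure, PART 140's generic END; and the MIXED quintic of PART 121 in two backgrounds (unit b2b-balaban-gan24-p3, gen 55; v1)

NOT IN PRINT; OUR PROOF ([folklore] bookkeeping BY NAME over PART 156 (`mul_inputs`, `inputs_of_le_rate`, `insertionChain_decay_inputs`, `tendsto_chain1_pair`, `tendsto_chain2_pair`), PART 143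
(`invCov_inputs`), PART 130 (`entryDecay_smul ∕ _sub`, `twoLevelDecayRate_smul ∕ _sub`), PART 140 (`conv_of_decay_of_tendsto`); [Balaban1987RG1] (1.21)–(1.22) p. 264 LOCATE the shapes;
nothing printed is a hypothesis).
HONEST FRAMING (cell contract, verbatim): «discharging `BetaPertH` makes Bałaban's UV stability UNCONDITIONAL — a real constructive-QFT result; it is NOT the
continuum limit and NOT the Clay problem.»  HONEST DEPENDENCY (verbatim): «continuum YM on T⁴ ⇐ BetaPertH ∧ nine spine estimates (0/9 proved); BetaPertH ⇐
(D1) ∧ (D4) ∧ CAP+tail; G-an2-4 gates asym, D1 and NE2/3/4.»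

WHAT THIS FILE PROVES (0 sorry, 0 `def`; `c_k = unitCovB k`, `X^{(n)}_k = avgTow QBlev (L^d) (k ↦ ((Δ_a^{(k)})⁻¹P^{(k)})^n(Δ_a^{(k)})⁻¹) k`, `e = unitIdx⁻¹`):
* **`conv_secondDerivative_of_tendsto_background`** — `d ≥ 3`, `L ≥ 2`, `a > 0`, `μ ≠ ν`, even cubic volumes `2(t+1)`; a volume-indexed family of Lipschitz backgrounds (`α, β` uniform)
  DISPLAYING ONLY EL₁ (`∀ k μ f z, ∃ s, V_t k μ (ẑ_t,f) → s`): `∃ δ₀ > 0, B, B′ ≥ 0, Π` with `IsInfiniteVolumeLimit evenPeriod (Re Σ̈_k(e(·,μ′),e(0,ν′))) (Π k)`, `UniformDecay Π μ ν B (δ₀∕d)`,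
  `StepRate Π μ ν B′ (δ₀∕d) (√(L⁻¹))`, `KernelInputs d Π`, `∀ k, |secondMoment (Π k) μ ν − secondMoment (limKernelOf Π) μ ν| ≤ β′_d(B′∕(1−√(L⁻¹)), δ₀∕d)·(√(L⁻¹))^k`.
* `conv_secondDerivative_constBackground` — the same with NOTHING displayed for constant backgrounds `V_t k μ ≡ v_μ`.
* `tendsto_avgIns_pair_of_tendsto`, **`conv_mixedQuintic_of_tendsto_background`** — PART 121's mixed quintic `c_k⁻¹ċ^{(1)}_kc_k⁻¹ċ^{(2)}_kc_k⁻¹` in TWO backgrounds (the `V_{bb′}` class) has the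
  same END modulo EL₁ of both backgrounds.
WHAT IT DOES NOT DO: identify `Σ̈_k` with Bałaban's `Π⁰_{k+1}` (row an1's dictionary; `Σ_k` is the (1.65)-dictionary effective form); PART 123's `c_k⁻¹c_{k,st}c_k⁻¹` piece of `V_{bb′}`
(PART 119's mixed insertion tower — same tools, follower); `U ≠ 1`; `d ≤ 2` ∕ odd volumes.  SUPPLIER work; NEVER «G-an2-4 closed»; NOT (CONV-C), NOT D1, NOT `BetaPertH`,
NOT continuum, NOT Clay.  Records: `HOME/b2b-balaban-gan24-p3/gen55/README.md`.
-/

noncomputable section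

open scoped BigOperators ComplexConjugate Matrix Matrix.Norms.L2Operator
open Filter Topology

namespace Summit.QuantumFields.BalabanUV.Beta.GAN24.SecondDerivativeVolumeLimit

open Literature.MathematicalPhysics.QuantumFieldTheory.Balaban1983to89
open Literature.MathematicalPhysics.QuantumFieldTheory.Balaban1983to89.B5Prop11Plancherel (Tor fine)
open Literature.MathematicalPhysics.QuantumFieldTheory.Balaban1983to89.B5G183RateUnitTower (lev)
open Literature.MathematicalPhysics.QuantumFieldTheory.Balaban1983to89.B12Sec2to5 (betaPrime510)
open Literature.MathematicalPhysics.QuantumFieldTheory.Balaban1983to89.Beta (Site IsInfiniteVolumeLimit)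
open Literature.MathematicalPhysics.QuantumFieldTheory.Balaban1983to89.Beta.FreeLegDictionary (cubic)
open Literature.MathematicalPhysics.QuantumFieldTheory.Balaban1983to89.Beta.BlockKernelVolumeSockets (evenPeriod tendsto_evenPeriod)
open Literature.MathematicalPhysics.QuantumFieldTheory.Balaban1983to89.Beta.VectorTails (castT)
open Literature.MathematicalPhysics.QuantumFieldTheory.Balaban1983to89.Beta.LimitRate (StepRate limKernelOf KernelInputs)
open Summit.QuantumFields.BalabanUV.T4Continuum
open Summit.QuantumFields.BalabanUV.T4Continuum.CovariantAveragingTower (avgTow)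
open Summit.QuantumFields.BalabanUV.T4Continuum.BalabanAveragedTowerUnit (idx QBlev calGlev unitCovB)
open Summit.QuantumFields.BalabanUV.T4Continuum.BalabanAveragedCoerciveTower (unitIdx)
open Summit.QuantumFields.BalabanUV.T4Continuum.KingPairingPlantedLaw (calDalev)
open Summit.QuantumFields.BalabanUV.T4Continuum.FirstOrderBackgroundModel (LipschitzBackground Pmodel)
open Summit.QuantumFields.BalabanUV.T4Continuum.CTKingTowerWeights (distK)
open Summit.QuantumFields.BalabanUV.T4Continuum.DecayRateInterpolation (EntryDecay TwoLevelDecayRate entryDecay_sub)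
open Summit.QuantumFields.BalabanUV.Beta.GAN24.DiagramDecayAlgebra (twoLevelDecayRate_sub twoLevelDecayRate_smul)
open Summit.QuantumFields.BalabanUV.Beta.GAN24.UnitLatticeDecayAlgebra (entryDecay_smul)
open Summit.QuantumFields.BalabanUV.Beta.GAN24.DiagramVolumeLimit (conv_of_decay_of_tendsto)
open Summit.QuantumFields.BalabanUV.Beta.GAN24.DiagramVolumeLimitSandwich (invCov_inputs)
open Summit.QuantumFields.BalabanUV.Beta.GAN24.ConstantBackgroundVolumeLimit (lipschitzBackground_of_const)
open Summit.QuantumFields.BalabanUV.Beta.GAN24.FineInsertionVolumeLimit (tendsto_avgInsertion_pair)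
open Summit.QuantumFields.BalabanUV.Beta.GAN24.EffectiveFormInsertionVolumeLimit (norm_Pmodel_apply_le insertion_decay_inputs)
open Summit.QuantumFields.BalabanUV.Beta.GAN24.BackgroundVolumeLimit (tendsto_Pmodel_pair_of_tendsto)
open Summit.QuantumFields.BalabanUV.Beta.GAN24.InsertionChainVolumeLimit (mul_inputs inputs_of_le_rate insertionChain_decay_inputs tendsto_chain1_pair tendsto_chain2_pair)

variable {d : ℕ} (L : ℕ) [NeZero L] (a : ℝ) (ha : 0 < a)

/-- **`conv_secondDerivative_of_tendsto_background` — THE SECOND u-DERIVATIVE SECTOR ON `ℤ^d`, MODULO ONLY THE BACKGROUND's POINTWISE LIMIT** [our proof] (`d ≥ 3`, `L ≥ 2`, `a > 0`,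
`μ ≠ ν`, along the even cubic volumes `2(t+1)`): for a volume-indexed family of backgrounds with `LipschitzBackground L (cubic d (2(t+1))) (V t) α β` whose readings converge at every fixed
fine integer point (DISPLAYED), the tower `Σ̈_k = 2·(c_k⁻¹X^{(1)}_kc_k⁻¹X^{(1)}_kc_k⁻¹ − c_k⁻¹X^{(2)}_kc_k⁻¹)` has: `δ₀ > 0`, `B, B′ ≥ 0`, limit kernels `Π_k` with
`IsInfiniteVolumeLimit evenPeriod (Re Σ̈_k(e(·,μ′),e(0,ν′))) (Π k)`, `UniformDecay Π μ ν B (δ₀∕d)`, `StepRate Π μ ν B′ (δ₀∕d) (√(L⁻¹))`, `KernelInputs d Π`, and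
`∀ k, |secondMoment (Π k) μ ν − secondMoment (limKernelOf Π) μ ν| ≤ β′_d(B′∕(1−√(L⁻¹)), δ₀∕d)·(√(L⁻¹))^k`. [cite: Balaban1987RG1, (1.21)–(1.22) p.264 (shapes)] -/
theorem conv_secondDerivative_of_tendsto_background (hL : 2 ≤ L) (hd : 3 ≤ d) {μ ν : Fin d} (hne : μ ≠ ν) {α β : ℝ}
    {V : (t : ℕ) → (k : ℕ) → Fin d → (idx L (cubic d (evenPeriod t)) k → ℂ)} (hV : ∀ t, LipschitzBackground L (cubic d (evenPeriod t)) (V t) α β)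
    (hV1 : ∀ k (μ f : Fin d) (z : Fin d → ℤ), ∃ s : ℂ, Tendsto (fun t => V t k μ (castT (cubic d (lev L k * evenPeriod t)) z, f)) atTop (𝓝 s)) :
    ∃ δ₀ B B' : ℝ, 0 < δ₀ ∧ 0 ≤ B ∧ 0 ≤ B' ∧ ∃ Pinf : ℕ → B12Beta.Kernel d,
      (∀ k, IsInfiniteVolumeLimit evenPeriod
        (fun t μ' ν' (z : Site d (evenPeriod t)) =>
          (((2 : ℂ) • ((unitCovB L (cubic d (evenPeriod t)) a ha k)⁻¹
                * avgTow (QBlev L (cubic d (evenPeriod t))) ((L : ℝ) ^ d)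
                    (fun k' => ((calDalev L (cubic d (evenPeriod t)) a ha k')⁻¹ * Pmodel L (cubic d (evenPeriod t)) (V t) k') ^ 1 * (calDalev L (cubic d (evenPeriod t)) a ha k')⁻¹) k
                * (unitCovB L (cubic d (evenPeriod t)) a ha k)⁻¹
                * avgTow (QBlev L (cubic d (evenPeriod t))) ((L : ℝ) ^ d)
                    (fun k' => ((calDalev L (cubic d (evenPeriod t)) a ha k')⁻¹ * Pmodel L (cubic d (evenPeriod t)) (V t) k') ^ 1 * (calDalev L (cubic d (evenPeriod t)) a ha k')⁻¹) k
                * (unitCovB L (cubic d (evenPeriod t)) a ha k)⁻¹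
              - (unitCovB L (cubic d (evenPeriod t)) a ha k)⁻¹
                * avgTow (QBlev L (cubic d (evenPeriod t))) ((L : ℝ) ^ d)
                    (fun k' => ((calDalev L (cubic d (evenPeriod t)) a ha k')⁻¹ * Pmodel L (cubic d (evenPeriod t)) (V t) k') ^ 2 * (calDalev L (cubic d (evenPeriod t)) a ha k')⁻¹) k
                * (unitCovB L (cubic d (evenPeriod t)) a ha k)⁻¹))
            ((unitIdx L (cubic d (evenPeriod t))).symm (z, μ')) ((unitIdx L (cubic d (evenPeriod t))).symm (0, ν'))).re) (Pinf k)) ∧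
      Beta.LimitRate.UniformDecay Pinf μ ν B (δ₀ / d) ∧ StepRate Pinf μ ν B' (δ₀ / d) (Real.sqrt ((L : ℝ)⁻¹)) ∧
      (∃ K : KernelInputs d Pinf, K.θ = Real.sqrt ((L : ℝ)⁻¹) ∧ K.c₀ = betaPrime510 d (B' / (1 - Real.sqrt ((L : ℝ)⁻¹))) (δ₀ / d) ∧ K.Pinf = limKernelOf Pinf ∧ K.μ = μ ∧ K.ν = ν) ∧
      (∀ k, |B12Beta.secondMoment (Pinf k) μ ν - B12Beta.secondMoment (limKernelOf Pinf) μ ν|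
          ≤ betaPrime510 d (B' / (1 - Real.sqrt ((L : ℝ)⁻¹))) (δ₀ / d) * Real.sqrt ((L : ℝ)⁻¹) ^ k) := by
  have hd1 : 1 ≤ d := le_trans (by norm_num) hd
  have hd2 : 2 ≤ d := le_trans (by norm_num) hd
  have hL1 : (1 : ℝ) < L := by exact_mod_cast (lt_of_lt_of_le one_lt_two hL : 1 < L)
  have hθ0 : 0 ≤ Real.sqrt ((L : ℝ)⁻¹) := Real.sqrt_nonneg _
  have hθ1 : Real.sqrt ((L : ℝ)⁻¹) < 1 := by
    rw [show (1 : ℝ) = Real.sqrt 1 from Real.sqrt_one.symm]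
    exact Real.sqrt_lt_sqrt (inv_nonneg.mpr (Nat.cast_nonneg _)) (inv_lt_one_of_one_lt₀ hL1)
  -- the three constituents as volume families
  set C : (t : ℕ) → ℕ → Matrix (idx L (cubic d (evenPeriod t)) 0) (idx L (cubic d (evenPeriod t)) 0) ℂ := fun t k => (unitCovB L (cubic d (evenPeriod t)) a ha k)⁻¹ with hC
  set X1 : (t : ℕ) → ℕ → Matrix (idx L (cubic d (evenPeriod t)) 0) (idx L (cubic d (evenPeriod t)) 0) ℂ := fun t k =>
    avgTow (QBlev L (cubic d (evenPeriod t))) ((L : ℝ) ^ d)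
      (fun k' => ((calDalev L (cubic d (evenPeriod t)) a ha k')⁻¹ * Pmodel L (cubic d (evenPeriod t)) (V t) k') ^ 1 * (calDalev L (cubic d (evenPeriod t)) a ha k')⁻¹) k with hX1
  set X2 : (t : ℕ) → ℕ → Matrix (idx L (cubic d (evenPeriod t)) 0) (idx L (cubic d (evenPeriod t)) 0) ℂ := fun t k =>
    avgTow (QBlev L (cubic d (evenPeriod t))) ((L : ℝ) ^ d)
      (fun k' => ((calDalev L (cubic d (evenPeriod t)) a ha k')⁻¹ * Pmodel L (cubic d (evenPeriod t)) (V t) k') ^ 2 * (calDalev L (cubic d (evenPeriod t)) a ha k')⁻¹) k with hX2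
  -- their inputs
  obtain ⟨κc, Bc, Bc', hκc, hBc, hBc', hcud, hcsr, hcel⟩ := invCov_inputs L a ha hL hd
  obtain ⟨κ₁, B₁, B₁', hκ₁, hB₁, hB₁', h1⟩ := insertionChain_decay_inputs L a ha hL hd1 α β 1
  obtain ⟨κ₂, B₂, B₂', hκ₂, hB₂, hB₂', h2⟩ := insertionChain_decay_inputs L a ha hL hd1 α β 2
  set κ₀ : ℝ := min κc (min κ₁ κ₂) with hκ₀
  have hκ₀0 : 0 < κ₀ := lt_min hκc (lt_min hκ₁ hκ₂)
  have hκ₀c : κ₀ ≤ κc := min_le_left _ _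
  have hκ₀1 : κ₀ ≤ κ₁ := (min_le_right _ _).trans (min_le_left _ _)
  have hκ₀2 : κ₀ ≤ κ₂ := (min_le_right _ _).trans (min_le_right _ _)
  have hCin : (∀ t k, EntryDecay (distK L (cubic d (evenPeriod t))) (C t k) Bc κ₀) ∧
      (∀ t, TwoLevelDecayRate (distK L (cubic d (evenPeriod t))) (C t) Bc' κ₀ (Real.sqrt ((L : ℝ)⁻¹))) :=
    inputs_of_le_rate L (side := evenPeriod) (X := C) hBc hBc' hθ0 hκ₀c (fun t k => hcud (evenPeriod t) k) (fun t => hcsr (evenPeriod t))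
  have hX1in : (∀ t k, EntryDecay (distK L (cubic d (evenPeriod t))) (X1 t k) B₁ κ₀) ∧
      (∀ t, TwoLevelDecayRate (distK L (cubic d (evenPeriod t))) (X1 t) B₁' κ₀ (Real.sqrt ((L : ℝ)⁻¹))) :=
    inputs_of_le_rate L (side := evenPeriod) (X := X1) hB₁ hB₁' hθ0 hκ₀1 (fun t k => (h1 (cubic d (evenPeriod t)) (V t) (hV t)).1 k)
      (fun t => (h1 (cubic d (evenPeriod t)) (V t) (hV t)).2)
  have hX2in : (∀ t k, EntryDecay (distK L (cubic d (evenPeriod t))) (X2 t k) B₂ κ₀) ∧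
      (∀ t, TwoLevelDecayRate (distK L (cubic d (evenPeriod t))) (X2 t) B₂' κ₀ (Real.sqrt ((L : ℝ)⁻¹))) :=
    inputs_of_le_rate L (side := evenPeriod) (X := X2) hB₂ hB₂' hθ0 hκ₀2 (fun t k => (h2 (cubic d (evenPeriod t)) (V t) (hV t)).1 k)
      (fun t => (h2 (cubic d (evenPeriod t)) (V t) (hV t)).2)
  have hCel : ∀ k μ ν (z z' : Fin d → ℤ), ∃ s' : ℂ, Tendsto (fun t => C t k ((unitIdx L (cubic d (evenPeriod t))).symm (castT (cubic d (evenPeriod t)) z, μ))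
      ((unitIdx L (cubic d (evenPeriod t))).symm (castT (cubic d (evenPeriod t)) z', ν))) atTop (𝓝 s') := hcel
  have hX1el : ∀ k μ ν (z z' : Fin d → ℤ), ∃ s' : ℂ, Tendsto (fun t => X1 t k ((unitIdx L (cubic d (evenPeriod t))).symm (castT (cubic d (evenPeriod t)) z, μ))
      ((unitIdx L (cubic d (evenPeriod t))).symm (castT (cubic d (evenPeriod t)) z', ν))) atTop (𝓝 s') :=
    fun k μ ν z z' => tendsto_chain1_pair L a ha hd k hV (hV1 k) μ ν z z'
  have hX2el : ∀ k μ ν (z z' : Fin d → ℤ), ∃ s' : ℂ, Tendsto (fun t => X2 t k ((unitIdx L (cubic d (evenPeriod t))).symm (castT (cubic d (evenPeriod t)) z, μ))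
      ((unitIdx L (cubic d (evenPeriod t))).symm (castT (cubic d (evenPeriod t)) z', ν))) atTop (𝓝 s') :=
    fun k μ ν z z' => tendsto_chain2_pair L a ha hd k hV (hV1 k) μ ν z z'
  -- A = c⁻¹X¹c⁻¹X¹c⁻¹: four product steps (rates κ₀/2, /4, /8, /16)
  obtain ⟨S₁, hS₁, hud₁, hsr₁, hel₁⟩ := mul_inputs L hd2 tendsto_evenPeriod (X := C) (Y := X1) hκ₀0 hBc hCin.1 hCin.2 hX1in.1 hX1in.2 hCel hX1el
  have hC2 := inputs_of_le_rate L (side := evenPeriod) (X := C) hBc hBc' hθ0 (half_le_self hκ₀0.le) hCin.1 hCin.2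
  obtain ⟨S₂, hS₂, hud₂, hsr₂, hel₂⟩ := mul_inputs L hd2 tendsto_evenPeriod (X := fun t k => C t k * X1 t k) (Y := C) (half_pos hκ₀0) (by positivity)
    hud₁ hsr₁ hC2.1 hC2.2 hel₁ hCel
  have hX14 := inputs_of_le_rate L (side := evenPeriod) (X := X1) hB₁ hB₁' hθ0
    (show κ₀ / 2 / 2 ≤ κ₀ by linarith [half_le_self hκ₀0.le, half_le_self (half_pos hκ₀0).le]) hX1in.1 hX1in.2
  obtain ⟨S₃, hS₃, hud₃, hsr₃, hel₃⟩ := mul_inputs L hd2 tendsto_evenPeriod (X := fun t k => C t k * X1 t k * C t k) (Y := X1) (half_pos (half_pos hκ₀0)) (by positivity)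
    hud₂ hsr₂ hX14.1 hX14.2 hel₂ hX1el
  have hC8 := inputs_of_le_rate L (side := evenPeriod) (X := C) hBc hBc' hθ0
    (show κ₀ / 2 / 2 / 2 ≤ κ₀ by linarith [half_le_self hκ₀0.le, half_le_self (half_pos hκ₀0).le, half_le_self (half_pos (half_pos hκ₀0)).le]) hCin.1 hCin.2
  obtain ⟨S₄, hS₄, hudA, hsrA, helA⟩ := mul_inputs L hd2 tendsto_evenPeriod (X := fun t k => C t k * X1 t k * C t k * X1 t k) (Y := C)
    (half_pos (half_pos (half_pos hκ₀0))) (by positivity) hud₃ hsr₃ hC8.1 hC8.2 hel₃ hCel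
  -- B = c⁻¹X²c⁻¹: two product steps, then down to the common rate κ₀/16
  obtain ⟨T₁, hT₁, hud₅, hsr₅, hel₅⟩ := mul_inputs L hd2 tendsto_evenPeriod (X := C) (Y := X2) hκ₀0 hBc hCin.1 hCin.2 hX2in.1 hX2in.2 hCel hX2el
  obtain ⟨T₂, hT₂, hud₆, hsr₆, hel₆⟩ := mul_inputs L hd2 tendsto_evenPeriod (X := fun t k => C t k * X2 t k) (Y := C) (half_pos hκ₀0) (by positivity)
    hud₅ hsr₅ hC2.1 hC2.2 hel₅ hCel
  have hBin := inputs_of_le_rate L (side := evenPeriod) (X := fun t k => C t k * X2 t k * C t k) (by positivity) (by positivity) hθ0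
    (show κ₀ / 2 / 2 / 2 / 2 ≤ κ₀ / 2 / 2 by linarith [half_le_self (half_pos (half_pos hκ₀0)).le, half_le_self (half_pos (half_pos (half_pos hκ₀0))).le]) hud₆ hsr₆
  -- Σ̈ = 2·(A − B): linear closure, the entry limits at the origin pairs, PART 140's generic END
  have hlim : ∀ k (μ' ν' : Fin d) (z : Fin d → ℤ), ∃ s' : ℂ, Tendsto (fun t => ((2 : ℂ) • (C t k * X1 t k * C t k * X1 t k * C t k - C t k * X2 t k * C t k))
      ((unitIdx L (cubic d (evenPeriod t))).symm (castT (cubic d (evenPeriod t)) z, μ')) ((unitIdx L (cubic d (evenPeriod t))).symm (0, ν'))) atTop (𝓝 s') := by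
    intro k μ' ν' z
    obtain ⟨sA, hsA⟩ := helA k μ' ν' z 0
    obtain ⟨sB, hsB⟩ := hel₆ k μ' ν' z 0
    refine ⟨2 * (sA - sB), ?_⟩
    have e0 : ∀ t, castT (cubic d (evenPeriod t)) (0 : Fin d → ℤ) = 0 := fun t => by funext i; simp [castT]
    simp only [e0] at hsA hsB
    simp only [Matrix.smul_apply, Matrix.sub_apply, smul_eq_mul]
    exact (hsA.sub hsB).const_mul 2
  obtain ⟨Pinf, hP⟩ := conv_of_decay_of_tendsto L hd1 tendsto_evenPeriod (δ := κ₀ / 2 / 2 / 2 / 2) (by positivity) hθ0 hθ1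
    (c := fun t k => (2 : ℂ) • (C t k * X1 t k * C t k * X1 t k * C t k - C t k * X2 t k * C t k))
    (fun t k => entryDecay_smul (entryDecay_sub (hudA t k) (hBin.1 t k)) 2)
    (fun t => twoLevelDecayRate_smul (twoLevelDecayRate_sub (hsrA t) (hBin.2 t)) 2) hlim hne
  exact ⟨κ₀ / 2 / 2 / 2 / 2, _, _, by positivity, by positivity, by positivity, Pinf, hP⟩

/-- **`conv_secondDerivative_constBackground`** — the second u-derivative sector on `ℤ^d` with NOTHING displayed for constant backgrounds `V_t k μ ≡ v_μ` (PART 148's Lipschitz witness, EL₁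
trivially). [cite: Balaban1987RG1, (1.21)–(1.22) p.264 (shapes)] -/
theorem conv_secondDerivative_constBackground (hL : 2 ≤ L) (hd : 3 ≤ d) {μ ν : Fin d} (hne : μ ≠ ν) (v : Fin d → ℂ)
    (V : (t : ℕ) → (k : ℕ) → Fin d → (idx L (cubic d (evenPeriod t)) k → ℂ)) (hV : ∀ t k μ i, V t k μ i = v μ) :
    ∃ δ₀ B B' : ℝ, 0 < δ₀ ∧ 0 ≤ B ∧ 0 ≤ B' ∧ ∃ Pinf : ℕ → B12Beta.Kernel d,
      (∀ k, IsInfiniteVolumeLimit evenPeriod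
        (fun t μ' ν' (z : Site d (evenPeriod t)) =>
          (((2 : ℂ) • ((unitCovB L (cubic d (evenPeriod t)) a ha k)⁻¹
                * avgTow (QBlev L (cubic d (evenPeriod t))) ((L : ℝ) ^ d)
                    (fun k' => ((calDalev L (cubic d (evenPeriod t)) a ha k')⁻¹ * Pmodel L (cubic d (evenPeriod t)) (V t) k') ^ 1 * (calDalev L (cubic d (evenPeriod t)) a ha k')⁻¹) k
                * (unitCovB L (cubic d (evenPeriod t)) a ha k)⁻¹
                * avgTow (QBlev L (cubic d (evenPeriod t))) ((L : ℝ) ^ d)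
                    (fun k' => ((calDalev L (cubic d (evenPeriod t)) a ha k')⁻¹ * Pmodel L (cubic d (evenPeriod t)) (V t) k') ^ 1 * (calDalev L (cubic d (evenPeriod t)) a ha k')⁻¹) k
                * (unitCovB L (cubic d (evenPeriod t)) a ha k)⁻¹
              - (unitCovB L (cubic d (evenPeriod t)) a ha k)⁻¹
                * avgTow (QBlev L (cubic d (evenPeriod t))) ((L : ℝ) ^ d)
                    (fun k' => ((calDalev L (cubic d (evenPeriod t)) a ha k')⁻¹ * Pmodel L (cubic d (evenPeriod t)) (V t) k') ^ 2 * (calDalev L (cubic d (evenPeriod t)) a ha k')⁻¹) k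
                * (unitCovB L (cubic d (evenPeriod t)) a ha k)⁻¹))
            ((unitIdx L (cubic d (evenPeriod t))).symm (z, μ')) ((unitIdx L (cubic d (evenPeriod t))).symm (0, ν'))).re) (Pinf k)) ∧
      Beta.LimitRate.UniformDecay Pinf μ ν B (δ₀ / d) ∧ StepRate Pinf μ ν B' (δ₀ / d) (Real.sqrt ((L : ℝ)⁻¹)) ∧
      (∃ K : KernelInputs d Pinf, K.θ = Real.sqrt ((L : ℝ)⁻¹) ∧ K.c₀ = betaPrime510 d (B' / (1 - Real.sqrt ((L : ℝ)⁻¹))) (δ₀ / d) ∧ K.Pinf = limKernelOf Pinf ∧ K.μ = μ ∧ K.ν = ν) ∧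
      (∀ k, |B12Beta.secondMoment (Pinf k) μ ν - B12Beta.secondMoment (limKernelOf Pinf) μ ν|
          ≤ betaPrime510 d (B' / (1 - Real.sqrt ((L : ℝ)⁻¹))) (δ₀ / d) * Real.sqrt ((L : ℝ)⁻¹) ^ k) := by
  have hα : ∀ μ, ‖v μ‖ ≤ ∑ μ, ‖v μ‖ := fun μ => Finset.single_le_sum (fun μ _ => norm_nonneg (v μ)) (Finset.mem_univ μ)
  exact conv_secondDerivative_of_tendsto_background L a ha hL hd hne
    (fun t => lipschitzBackground_of_const L (cubic d (evenPeriod t)) (Finset.sum_nonneg fun μ _ => norm_nonneg (v μ)) hα (V t) (hV t))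
    (fun k μ f z => ⟨v μ, tendsto_const_nhds.congr fun t => (hV t k μ _).symm⟩)

/-! ## The mixed quintic in two backgrounds (PART 121's `V_{bb′}` class) -/

/-- EL₂ of the averaged first-order insertion `L^{dk}Q_k(𝒢^{(k)}P(W_t)^{(k)}𝒢^{(k)})Q_kᴴ` at unit integer pairs from EL₁ of the background `W_t` (PART 146's `tendsto_avgInsertion_pair` with PART
147's entry bound and PART 149's EL₂ of `P`, read through `e = unitIdx⁻¹`). [folklore] -/
theorem tendsto_avgIns_pair_of_tendsto (hd : 3 ≤ d) (k : ℕ) {α β : ℝ}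
    {W : (t : ℕ) → (k : ℕ) → Fin d → (idx L (cubic d (evenPeriod t)) k → ℂ)} (hW : ∀ t, LipschitzBackground L (cubic d (evenPeriod t)) (W t) α β)
    (hW1 : ∀ (μ f : Fin d) (z : Fin d → ℤ), ∃ s : ℂ, Tendsto (fun t => W t k μ (castT (cubic d (lev L k * evenPeriod t)) z, f)) atTop (𝓝 s))
    (μ ν : Fin d) (z z' : Fin d → ℤ) :
    ∃ s : ℂ, Tendsto (fun t => (avgTow (QBlev L (cubic d (evenPeriod t))) ((L : ℝ) ^ d)
        (fun k' => calGlev L (cubic d (evenPeriod t)) a ha k' * Pmodel L (cubic d (evenPeriod t)) (W t) k' * calGlev L (cubic d (evenPeriod t)) a ha k') k)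
      ((unitIdx L (cubic d (evenPeriod t))).symm (castT (cubic d (evenPeriod t)) z, μ)) ((unitIdx L (cubic d (evenPeriod t))).symm (castT (cubic d (evenPeriod t)) z', ν))) atTop (𝓝 s) := by
  have hα : 0 ≤ α := (hW 0).nonneg.1
  have hb0 : 0 ≤ d * (α * (2 * lev L k)) := by positivity
  obtain ⟨s, hs⟩ := tendsto_avgInsertion_pair L a ha hd k (P := fun t k' => Pmodel L (cubic d (evenPeriod t)) (W t) k') hb0
    (fun t w' g' y h' => norm_Pmodel_apply_le L (cubic d (evenPeriod t)) (hW t) k _ _)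
    (fun f' g' u u' => tendsto_Pmodel_pair_of_tendsto L tendsto_evenPeriod k W hW1 f' g' u u') μ ν z z'
  refine ⟨s, hs.congr fun t => ?_⟩
  simp only [Matrix.reindex_apply, Matrix.submatrix_apply]

/-- **`conv_mixedQuintic_of_tendsto_background` — THE MIXED QUINTIC `c_k⁻¹ċ^{(1)}_kc_k⁻¹ċ^{(2)}_kc_k⁻¹` IN TWO BACKGROUNDS ON `ℤ^d`** [our proof] (PART 121's `effInsMixed_balaban` object —
the `V_{bb′}` class; `ċ^{(i)}_k = L^{dk}Q_k(𝒢P(V_i)𝒢)Q_kᴴ`; `d ≥ 3`, `L ≥ 2`, `a > 0`, `μ ≠ ν`, even cubic volumes): for two volume-indexed families of Lipschitz backgrounds with common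
`(α, β)` DISPLAYING ONLY their EL₁, the quintic tower has the β-cell's whole `LimitRate` END on `ℤ^d` (PART 147's insertion inputs, PART 143's `c_k⁻¹` inputs, four product steps of PART
156's `mul_inputs`, PART 140's generic END). [cite: Balaban1987RG1, (1.21)–(1.22) p.264 (shapes)] -/
theorem conv_mixedQuintic_of_tendsto_background (hL : 2 ≤ L) (hd : 3 ≤ d) {μ ν : Fin d} (hne : μ ≠ ν) {α β : ℝ}
    {V₁ V₂ : (t : ℕ) → (k : ℕ) → Fin d → (idx L (cubic d (evenPeriod t)) k → ℂ)}
    (hV₁ : ∀ t, LipschitzBackground L (cubic d (evenPeriod t)) (V₁ t) α β) (hV₂ : ∀ t, LipschitzBackground L (cubic d (evenPeriod t)) (V₂ t) α β)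
    (hV₁1 : ∀ k (μ f : Fin d) (z : Fin d → ℤ), ∃ s : ℂ, Tendsto (fun t => V₁ t k μ (castT (cubic d (lev L k * evenPeriod t)) z, f)) atTop (𝓝 s))
    (hV₂1 : ∀ k (μ f : Fin d) (z : Fin d → ℤ), ∃ s : ℂ, Tendsto (fun t => V₂ t k μ (castT (cubic d (lev L k * evenPeriod t)) z, f)) atTop (𝓝 s)) :
    ∃ δ₀ B B' : ℝ, 0 < δ₀ ∧ 0 ≤ B ∧ 0 ≤ B' ∧ ∃ Pinf : ℕ → B12Beta.Kernel d,
      (∀ k, IsInfiniteVolumeLimit evenPeriod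
        (fun t μ' ν' (z : Site d (evenPeriod t)) =>
          (((unitCovB L (cubic d (evenPeriod t)) a ha k)⁻¹
              * avgTow (QBlev L (cubic d (evenPeriod t))) ((L : ℝ) ^ d)
                  (fun k' => calGlev L (cubic d (evenPeriod t)) a ha k' * Pmodel L (cubic d (evenPeriod t)) (V₁ t) k' * calGlev L (cubic d (evenPeriod t)) a ha k') k
              * (unitCovB L (cubic d (evenPeriod t)) a ha k)⁻¹
              * avgTow (QBlev L (cubic d (evenPeriod t))) ((L : ℝ) ^ d)
                  (fun k' => calGlev L (cubic d (evenPeriod t)) a ha k' * Pmodel L (cubic d (evenPeriod t)) (V₂ t) k' * calGlev L (cubic d (evenPeriod t)) a ha k') k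
              * (unitCovB L (cubic d (evenPeriod t)) a ha k)⁻¹)
            ((unitIdx L (cubic d (evenPeriod t))).symm (z, μ')) ((unitIdx L (cubic d (evenPeriod t))).symm (0, ν'))).re) (Pinf k)) ∧
      Beta.LimitRate.UniformDecay Pinf μ ν B (δ₀ / d) ∧ StepRate Pinf μ ν B' (δ₀ / d) (Real.sqrt ((L : ℝ)⁻¹)) ∧
      (∃ K : KernelInputs d Pinf, K.θ = Real.sqrt ((L : ℝ)⁻¹) ∧ K.c₀ = betaPrime510 d (B' / (1 - Real.sqrt ((L : ℝ)⁻¹))) (δ₀ / d) ∧ K.Pinf = limKernelOf Pinf ∧ K.μ = μ ∧ K.ν = ν) ∧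
      (∀ k, |B12Beta.secondMoment (Pinf k) μ ν - B12Beta.secondMoment (limKernelOf Pinf) μ ν|
          ≤ betaPrime510 d (B' / (1 - Real.sqrt ((L : ℝ)⁻¹))) (δ₀ / d) * Real.sqrt ((L : ℝ)⁻¹) ^ k) := by
  have hd1 : 1 ≤ d := le_trans (by norm_num) hd
  have hd2 : 2 ≤ d := le_trans (by norm_num) hd
  have hL1 : (1 : ℝ) < L := by exact_mod_cast (lt_of_lt_of_le one_lt_two hL : 1 < L)
  have hθ0 : 0 ≤ Real.sqrt ((L : ℝ)⁻¹) := Real.sqrt_nonneg _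
  have hθ1 : Real.sqrt ((L : ℝ)⁻¹) < 1 := by
    rw [show (1 : ℝ) = Real.sqrt 1 from Real.sqrt_one.symm]
    exact Real.sqrt_lt_sqrt (inv_nonneg.mpr (Nat.cast_nonneg _)) (inv_lt_one_of_one_lt₀ hL1)
  set C : (t : ℕ) → ℕ → Matrix (idx L (cubic d (evenPeriod t)) 0) (idx L (cubic d (evenPeriod t)) 0) ℂ := fun t k => (unitCovB L (cubic d (evenPeriod t)) a ha k)⁻¹ with hC
  set Y1 : (t : ℕ) → ℕ → Matrix (idx L (cubic d (evenPeriod t)) 0) (idx L (cubic d (evenPeriod t)) 0) ℂ := fun t k =>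
    avgTow (QBlev L (cubic d (evenPeriod t))) ((L : ℝ) ^ d)
      (fun k' => calGlev L (cubic d (evenPeriod t)) a ha k' * Pmodel L (cubic d (evenPeriod t)) (V₁ t) k' * calGlev L (cubic d (evenPeriod t)) a ha k') k with hY1
  set Y2 : (t : ℕ) → ℕ → Matrix (idx L (cubic d (evenPeriod t)) 0) (idx L (cubic d (evenPeriod t)) 0) ℂ := fun t k =>
    avgTow (QBlev L (cubic d (evenPeriod t))) ((L : ℝ) ^ d)
      (fun k' => calGlev L (cubic d (evenPeriod t)) a ha k' * Pmodel L (cubic d (evenPeriod t)) (V₂ t) k' * calGlev L (cubic d (evenPeriod t)) a ha k') k with hY2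
  obtain ⟨κc, Bc, Bc', hκc, hBc, hBc', hcud, hcsr, hcel⟩ := invCov_inputs L a ha hL hd
  obtain ⟨κ₁, B₁, B₁', hκ₁, hB₁, hB₁', h1⟩ := insertion_decay_inputs L a ha hL hd1 α β
  set κ₀ : ℝ := min κc κ₁ with hκ₀
  have hκ₀0 : 0 < κ₀ := lt_min hκc hκ₁
  have hCin : (∀ t k, EntryDecay (distK L (cubic d (evenPeriod t))) (C t k) Bc κ₀) ∧
      (∀ t, TwoLevelDecayRate (distK L (cubic d (evenPeriod t))) (C t) Bc' κ₀ (Real.sqrt ((L : ℝ)⁻¹))) :=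
    inputs_of_le_rate L (side := evenPeriod) (X := C) hBc hBc' hθ0 (min_le_left _ _) (fun t k => hcud (evenPeriod t) k) (fun t => hcsr (evenPeriod t))
  have hY1in : (∀ t k, EntryDecay (distK L (cubic d (evenPeriod t))) (Y1 t k) B₁ κ₀) ∧
      (∀ t, TwoLevelDecayRate (distK L (cubic d (evenPeriod t))) (Y1 t) B₁' κ₀ (Real.sqrt ((L : ℝ)⁻¹))) :=
    inputs_of_le_rate L (side := evenPeriod) (X := Y1) hB₁ hB₁' hθ0 (min_le_right _ _) (fun t k => (h1 (cubic d (evenPeriod t)) (V₁ t) (hV₁ t)).1 k)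
      (fun t => (h1 (cubic d (evenPeriod t)) (V₁ t) (hV₁ t)).2)
  have hY2in : (∀ t k, EntryDecay (distK L (cubic d (evenPeriod t))) (Y2 t k) B₁ κ₀) ∧
      (∀ t, TwoLevelDecayRate (distK L (cubic d (evenPeriod t))) (Y2 t) B₁' κ₀ (Real.sqrt ((L : ℝ)⁻¹))) :=
    inputs_of_le_rate L (side := evenPeriod) (X := Y2) hB₁ hB₁' hθ0 (min_le_right _ _) (fun t k => (h1 (cubic d (evenPeriod t)) (V₂ t) (hV₂ t)).1 k)
      (fun t => (h1 (cubic d (evenPeriod t)) (V₂ t) (hV₂ t)).2)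
  have hCel : ∀ k μ ν (z z' : Fin d → ℤ), ∃ s' : ℂ, Tendsto (fun t => C t k ((unitIdx L (cubic d (evenPeriod t))).symm (castT (cubic d (evenPeriod t)) z, μ))
      ((unitIdx L (cubic d (evenPeriod t))).symm (castT (cubic d (evenPeriod t)) z', ν))) atTop (𝓝 s') := hcel
  have hY1el : ∀ k μ ν (z z' : Fin d → ℤ), ∃ s' : ℂ, Tendsto (fun t => Y1 t k ((unitIdx L (cubic d (evenPeriod t))).symm (castT (cubic d (evenPeriod t)) z, μ))
      ((unitIdx L (cubic d (evenPeriod t))).symm (castT (cubic d (evenPeriod t)) z', ν))) atTop (𝓝 s') :=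
    fun k μ ν z z' => tendsto_avgIns_pair_of_tendsto L a ha hd k hV₁ (hV₁1 k) μ ν z z'
  have hY2el : ∀ k μ ν (z z' : Fin d → ℤ), ∃ s' : ℂ, Tendsto (fun t => Y2 t k ((unitIdx L (cubic d (evenPeriod t))).symm (castT (cubic d (evenPeriod t)) z, μ))
      ((unitIdx L (cubic d (evenPeriod t))).symm (castT (cubic d (evenPeriod t)) z', ν))) atTop (𝓝 s') :=
    fun k μ ν z z' => tendsto_avgIns_pair_of_tendsto L a ha hd k hV₂ (hV₂1 k) μ ν z z'
  -- four product steps (rates κ₀/2, /4, /8, /16)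
  obtain ⟨S₁, hS₁, hud₁, hsr₁, hel₁⟩ := mul_inputs L hd2 tendsto_evenPeriod (X := C) (Y := Y1) hκ₀0 hBc hCin.1 hCin.2 hY1in.1 hY1in.2 hCel hY1el
  have hC2 := inputs_of_le_rate L (side := evenPeriod) (X := C) hBc hBc' hθ0 (half_le_self hκ₀0.le) hCin.1 hCin.2
  obtain ⟨S₂, hS₂, hud₂, hsr₂, hel₂⟩ := mul_inputs L hd2 tendsto_evenPeriod (X := fun t k => C t k * Y1 t k) (Y := C) (half_pos hκ₀0) (by positivity)
    hud₁ hsr₁ hC2.1 hC2.2 hel₁ hCel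
  have hY24 := inputs_of_le_rate L (side := evenPeriod) (X := Y2) hB₁ hB₁' hθ0
    (show κ₀ / 2 / 2 ≤ κ₀ by linarith [half_le_self hκ₀0.le, half_le_self (half_pos hκ₀0).le]) hY2in.1 hY2in.2
  obtain ⟨S₃, hS₃, hud₃, hsr₃, hel₃⟩ := mul_inputs L hd2 tendsto_evenPeriod (X := fun t k => C t k * Y1 t k * C t k) (Y := Y2) (half_pos (half_pos hκ₀0)) (by positivity)
    hud₂ hsr₂ hY24.1 hY24.2 hel₂ hY2el
  have hC8 := inputs_of_le_rate L (side := evenPeriod) (X := C) hBc hBc' hθ0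
    (show κ₀ / 2 / 2 / 2 ≤ κ₀ by linarith [half_le_self hκ₀0.le, half_le_self (half_pos hκ₀0).le, half_le_self (half_pos (half_pos hκ₀0)).le]) hCin.1 hCin.2
  obtain ⟨S₄, hS₄, hudM, hsrM, helM⟩ := mul_inputs L hd2 tendsto_evenPeriod (X := fun t k => C t k * Y1 t k * C t k * Y2 t k) (Y := C)
    (half_pos (half_pos (half_pos hκ₀0))) (by positivity) hud₃ hsr₃ hC8.1 hC8.2 hel₃ hCel
  have hlim : ∀ k (μ' ν' : Fin d) (z : Fin d → ℤ), ∃ s' : ℂ, Tendsto (fun t => (C t k * Y1 t k * C t k * Y2 t k * C t k)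
      ((unitIdx L (cubic d (evenPeriod t))).symm (castT (cubic d (evenPeriod t)) z, μ')) ((unitIdx L (cubic d (evenPeriod t))).symm (0, ν'))) atTop (𝓝 s') := by
    intro k μ' ν' z
    obtain ⟨sM, hsM⟩ := helM k μ' ν' z 0
    have e0 : ∀ t, castT (cubic d (evenPeriod t)) (0 : Fin d → ℤ) = 0 := fun t => by funext i; simp [castT]
    simp only [e0] at hsM
    exact ⟨sM, hsM⟩
  obtain ⟨Pinf, hP⟩ := conv_of_decay_of_tendsto L hd1 tendsto_evenPeriod (δ := κ₀ / 2 / 2 / 2 / 2) (by positivity) hθ0 hθ1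
    (c := fun t k => C t k * Y1 t k * C t k * Y2 t k * C t k) hudM hsrM hlim hne
  exact ⟨κ₀ / 2 / 2 / 2 / 2, _, _, by positivity, by positivity, by positivity, Pinf, hP⟩

end Summit.QuantumFields.BalabanUV.Beta.GAN24.SecondDerivativeVolumeLimit


end
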